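import Mathlib
import Literature.AlgebraicGeometry.RelativeSpec.FreeQuotient

/-!
# Cyclic divisorial transfer — a prime fixed by the action on sections is the prime of a fixed point

Crux stmt-ResolutionOfSingularities-15640 (`WildQuotients.WildQuotientResolution`), line `Sketch`, stub
`stub_fixedPoint_of_comap_act` of the cyclic divisorial transfer.

For an action `ρ` of a group `G` on `X` over `r : X ⟶ Y` (`ActionOver r G`), an open `U ⊆ Y` with `r⁻¹U`
affine, `g ∈ G` and a prime `𝔮 ⊆ Γ(X, r⁻¹U)` with `(act g U)⁻¹ 𝔮 = 𝔮` (where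
`act g U = (g⁻¹)♯ : Γ(X, r⁻¹U) → Γ(X, r⁻¹U)` is the pull-back along `g⁻¹`), the point `x ∈ r⁻¹U`
corresponding to `𝔮` under `r⁻¹U ≅ Spec Γ(X, r⁻¹U)` is fixed by `g⁻¹`. The proof is the Mathlib fact that
`Spec` of `f.appLE U V` acts on the primes of points as `f` does on points
(`IsAffineOpen.comap_primeIdealOf_appLE`), together with injectivity of `x ↦ 𝔮_x` on an affine open
(`IsAffineOpen.fromSpec_primeIdealOf`).
-/

set_option linter.dupNamespace false

noncomputable section

open CategoryTheory Limits AlgebraicGeometry TopologicalSpace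
open Literature.AlgebraicGeometry.RelativeSpec

namespace Summit.ResolutionOfSingularities.ResolutionOfSingularities.Theorems.WildQuotientResolution.CyclicTransfer

/-- **A prime of the chart ring fixed by `act g` is the prime of a point fixed by `g⁻¹`.** For an action
`ρ : ActionOver r G`, an open `U ⊆ Y` with `r⁻¹U` affine and a prime `𝔮 ⊆ Γ(X, r⁻¹U)` with
`(act g U)⁻¹ 𝔮 = 𝔮`, the point `x ∈ r⁻¹U` with `𝔮 = 𝔮_x` (`IsAffineOpen.fromSpec`, `primeIdealOf`) satisfies
`g⁻¹ x = x`: `act g U = (g⁻¹).appLE (r⁻¹U) (r⁻¹U)` and the contraction of `𝔮_x` along `f.appLE` is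
`𝔮_{f x}` (Mathlib `IsAffineOpen.comap_primeIdealOf_appLE`), so `𝔮_{g⁻¹ x} = (act g U)⁻¹ 𝔮_x = 𝔮_x`,
and `x ↦ 𝔮_x` is injective (`IsAffineOpen.fromSpec_primeIdealOf`). [folklore] -/
theorem stub_fixedPoint_of_comap_act {X Y : Scheme.{0}} {r : X ⟶ Y} {G : Type} [Group G]
    (ρ : ActionOver r G) (U : Y.Opens) (hU : IsAffineOpen (r ⁻¹ᵁ U)) (g : G)
    (𝔮 : Ideal Γ(X, r ⁻¹ᵁ U)) [𝔮.IsPrime] (h𝔮 : 𝔮.comap (ρ.act g U) = 𝔮) :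
    ∃ (x : X) (hxU : x ∈ r ⁻¹ᵁ U), (hU.primeIdealOf ⟨x, hxU⟩).asIdeal = 𝔮 ∧
      (ρ.aut g⁻¹).hom.base x = x := by
  -- the point `x := fromSpec y` of `r⁻¹U` corresponding to the prime `y := 𝔮`, and `𝔮_x = y`
  let y : PrimeSpectrum Γ(X, r ⁻¹ᵁ U) := ⟨𝔮, inferInstance⟩
  have hxU : hU.fromSpec.base y ∈ r ⁻¹ᵁ U := hU.range_fromSpec.le ⟨y, rfl⟩
  have hx : hU.primeIdealOf ⟨hU.fromSpec.base y, hxU⟩ = y :=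
    hU.fromSpec.isOpenEmbedding.injective (hU.fromSpec_primeIdealOf ⟨hU.fromSpec.base y, hxU⟩)
  refine ⟨hU.fromSpec.base y, hxU, congrArg PrimeSpectrum.asIdeal hx, ?_⟩
  -- `𝔮_{g⁻¹ x} = (act g U)⁻¹ 𝔮_x = (act g U)⁻¹ 𝔮 = 𝔮 = 𝔮_x`
  have key := IsAffineOpen.comap_primeIdealOf_appLE (f := (ρ.aut g⁻¹).hom) (r ⁻¹ᵁ U) hU (r ⁻¹ᵁ U)
    hU (ρ.preimage_preimage g⁻¹ U).ge hxU
  have hfix : (hU.primeIdealOf ⟨hU.fromSpec.base y, hxU⟩).comap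
      ((ρ.aut g⁻¹).hom.appLE (r ⁻¹ᵁ U) (r ⁻¹ᵁ U) (ρ.preimage_preimage g⁻¹ U).ge).hom =
        hU.primeIdealOf ⟨hU.fromSpec.base y, hxU⟩ := by
    rw [hx]
    exact PrimeSpectrum.ext h𝔮
  rw [hfix] at key
  -- injectivity of `x ↦ 𝔮_x`: apply `fromSpec` and use `fromSpec 𝔮_x = x`
  have key' := congrArg (fun p ↦ hU.fromSpec.base p) key
  simpa only [IsAffineOpen.fromSpec_primeIdealOf] using key'.symm

end Summit.ResolutionOfSingularities.ResolutionOfSingularities.Theorems.WildQuotientResolution.CyclicTransfer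

end
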